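import Literature.NumberTheory.Rogawski1990.ArchHCSpaceG          -- ★ (D2′) `hcSwapAt`, `hcNrm`, `hcCayPt`, `hcAdaptedVec`, `hcCayVec`, `HcSemireg`, `ArchHCSpaceG` (+ ★ (COORD) `RegG`∕`InRegG`∕`negXAt`∕`archERhoG`)
import Literature.NumberTheory.Rogawski1990.ArchTransfFamily      -- ★ p849747: `slotPerm`, `partnerPerms`
import Literature.NumberTheory.Rogawski1990.ArchCentralLimitCompactWallOrbital   -- ★ `circleExp_ne_of_abs_sub_lt_two_pi` (reused, not restated)
import Mathlib.Topology.Algebra.Module.FiniteDimension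
import Mathlib.LinearAlgebra.StdBasis
import Mathlib.Analysis.SpecialFunctions.Complex.Circle
import HarnessLib

/-!
# (GLUE-X-dress) FILE B1 — wall geometry of the coordinate space: the slot swap, the sign change and the slot re-labelling as
# continuous linear automorphisms, the adapted basis, and small neighbourhoods of semiregular wall points
# (Shelstad 1979 §4 pp. 22–25; Bouaziz 1994 §3.2)

Topic `NumberTheory/Rogawski1990`; namespace `Literature.NumberTheory.Rogawski1990`.  THEOREMS ONLY (no `def`, no instance, no notation, no axiom, no named fact, no `sorry`):
the linear maps are delivered as `∃ A : E ≃L[ℝ] E, ∀ c, A c = …` packages.  Cell `pub/hodgecm-mathlib`, crux H413 (`stmt-HodgeConjecture-24833`), F0∕P3c line LH3 (closer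
stub `stub_N9`, DIRECT ROAD «Transf», organ O-L2); brick **(GLUE-X-dress)** (LH3-plan (g2) 2026-09-02T06:35:47Z), FILE B1 = the coordinate geometry consumed by the gluing
of the paired partner bracket across a `G`-wall (FILE B2) through ★ `Literature.Analysis.Calculus.SmoothGluingAcrossHyperplaneRay` ∕ `BoundedJetsLeibnizReflection`
(F0P3a-p02 (g19)), whose hypotheses are phrased with an abstract `A : E ≃L[ℝ] E`, a `Module.Basis`, a normal `v` and a functional `ℓ`.  Seat F0P3a-p09 (g5).

CONTENT (`E = W → Fin 3 → ℝ`, a compact place `w`, a pair of slots `x ≠ y`, third slot `k = hcThird x y`):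
* §1 `hcSwapAt w x y` (the transposition of the slots `x, y` at `w`) is a continuous linear involution `A`; on the adapted letters ★ `hcAdaptedVec w x y` it acts by the signs
  `ε_l = −1` on the normal letter `(w, x)` and `+1` on all others (`hcSwapAt_hcAdaptedVec`); `A (hcNrm w x y) = −hcNrm w x y`; wall points are fixed.
* §2 `negXAt w` (`x_w ↦ −x_w` in the split chart) is a continuous linear involution `R` acting on the Cayley letters ★ `hcCayVec w x y` by the SAME signs and fixing the
  Cayley point ★ `hcCayPt w x y c`; the twist ★ `archERhoG S′` is `negXAt w`-invariant for `w ∈ S′` and `C^∞`.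
* §3 the adapted letters form a basis `b : Module.Basis (W × Fin 3) ℝ E` with `b l = hcAdaptedVec w x y l`; the slot-difference functional `ℓ q = q w x − q w y` with
  `ℓ (hcNrm w x y) = 2` (the re-labelling `slotPerm ρ` as a continuous linear automorphism is ★ `exists_continuousLinearEquiv_eq_slotPerm` of
  `ArchTransfFamilyResolved`, LH3-p04 (g3) — not restated).
* §4 Around a semiregular wall point `p` (★ `HcSemireg S w x y p`, `w ∉ S`) there is an open `hcSwapAt`-stable neighbourhood `U` on which `|q w x − q w y| < π`, the third unit
  eigenvalue stays off the two colliding ones, every other compact place stays regular and every split place keeps `x ≠ 0`; consequently the off-wall points of `U` are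
  `G`-regular (★ `RegG S`), its wall points are semiregular, and for a sign pattern with `s w x = s w y` the whole of `U` lies in ★ `InRegG s S`; semiregularity is transported
  along `slotPerm ρ`, `ρ ∈ partnerPerms S`.
HONEST LABEL: HC_CM is proved only modulo the 7 printed citations (2 remaining named inputs: hLiu418 = `stmt-HodgeConjecture-24832`, h413 = `stmt-HodgeConjecture-24833`) until rung 0
closes; count-neutral geometry under O-L2, pays no organ.

## References
* [Shelstad1979] D. Shelstad, *Characters and inner forms of a quasi-split group over ℝ*, Compositio Math. 39 (1979) 11–45, §4 pp. 22–25 (semiregular elements, the reflection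
  `s_α`, property (II), the Cayley transform and the adapted basis of Lemma 4.3).
* [Bouaziz1994IntegralesOrbitales] A. Bouaziz, *Intégrales orbitales sur les algèbres de Lie réductives*, Invent. Math. 115 (1994), §3.2 pp. 579–580, §6.2 p. 591.
* [Rogawski1990] J. D. Rogawski, *Automorphic Representations of Unitary Groups in Three Variables*, Ann. of Math. Stud. 123 (1990), §4.3 p. 43 (partner labels).
-/

open Function Set Filter Topology Finset Complex
open scoped ContDiff
open Literature.NumberTheory.Automorphic.ArchCartan

namespace Literature.NumberTheory.Rogawski1990

variable {W : Type*} [DecidableEq W]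

/-! ## §0 Three slots -/

section Slots

/-- A slot other than `x` and `y` (`x ≠ y`) is the third slot. [cite: Shelstad1979, §4 p. 25] -/
theorem eq_hcThird_of_ne_of_ne {x y l : Fin 3} (hxy : x ≠ y) (hx : l ≠ x) (hy : l ≠ y) : l = hcThird x y := by
  revert x y l; unfold hcThird; decide

/-- Every slot is `x`, `y` or the third one. [cite: Shelstad1979, §4 p. 25] -/
theorem eq_or_eq_or_eq_hcThird {x y : Fin 3} (hxy : x ≠ y) (l : Fin 3) : l = x ∨ l = y ∨ l = hcThird x y := by
  by_cases hx : l = x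
  · exact Or.inl hx
  by_cases hy : l = y
  · exact Or.inr (Or.inl hy)
  exact Or.inr (Or.inr (eq_hcThird_of_ne_of_ne hxy hx hy))

/-- A slot permutation carries the third slot of a pair to the third slot of the image pair. [cite: Shelstad1979, §4 p. 25] -/
theorem perm_hcThird (σ : Equiv.Perm (Fin 3)) {x y : Fin 3} (hxy : x ≠ y) : σ (hcThird x y) = hcThird (σ x) (σ y) :=
  eq_hcThird_of_ne_of_ne (fun h => hxy (σ.injective h)) (fun h => hcThird_ne_left hxy (σ.injective h)) (fun h => hcThird_ne_right hxy (σ.injective h))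

/-- A map on the three slots is injective as soon as the pair `x ≠ y` and the third slot against both have distinct images. [cite: Shelstad1979, §4 p. 22] -/
theorem injective_of_pair_of_third {X : Type*} {f : Fin 3 → X} {x y : Fin 3} (hxy : x ≠ y) (hfxy : f x ≠ f y)
    (hthird : ∀ l, l ≠ x → l ≠ y → f l ≠ f x ∧ f l ≠ f y) : Function.Injective f := by
  intro i j h
  by_contra hij
  rcases eq_or_eq_or_eq_hcThird hxy i with hi | hi | hi <;> rcases eq_or_eq_or_eq_hcThird hxy j with hj | hj | hj
  · exact hij (hi.trans hj.symm)
  · exact hfxy (by rw [← hi, ← hj]; exact h)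
  · exact (hthird j (hj ▸ hcThird_ne_left hxy) (hj ▸ hcThird_ne_right hxy)).1 (by rw [← hi]; exact h.symm)
  · exact hfxy (by rw [← hi, ← hj]; exact h.symm)
  · exact hij (hi.trans hj.symm)
  · exact (hthird j (hj ▸ hcThird_ne_left hxy) (hj ▸ hcThird_ne_right hxy)).2 (by rw [← hi]; exact h.symm)
  · exact (hthird i (hi ▸ hcThird_ne_left hxy) (hi ▸ hcThird_ne_right hxy)).1 (by rw [← hj]; exact h)
  · exact (hthird i (hi ▸ hcThird_ne_left hxy) (hi ▸ hcThird_ne_right hxy)).2 (by rw [← hj]; exact h)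
  · exact hij (hi.trans hj.symm)

end Slots

/-! ## §1 The slot swap `hcSwapAt w x y` as a continuous linear involution, and its eigen-action on the adapted letters -/

section Swap

/-- `hcSwapAt` is additive. [cite: Shelstad1979, §4 p. 23] -/
theorem hcSwapAt_add (w : W) (x y : Fin 3) (c d : W → Fin 3 → ℝ) : hcSwapAt w x y (c + d) = hcSwapAt w x y c + hcSwapAt w x y d := by
  funext w' l
  by_cases h : w' = w
  · subst h; simp only [hcSwapAt_apply_self, Pi.add_apply]
  · simp only [hcSwapAt_apply_of_ne h, Pi.add_apply]

/-- `hcSwapAt` is homogeneous. [cite: Shelstad1979, §4 p. 23] -/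
theorem hcSwapAt_smul (w : W) (x y : Fin 3) (t : ℝ) (c : W → Fin 3 → ℝ) : hcSwapAt w x y (t • c) = t • hcSwapAt w x y c := by
  funext w' l
  by_cases h : w' = w
  · subst h; simp only [hcSwapAt_apply_self, Pi.smul_apply]
  · simp only [hcSwapAt_apply_of_ne h, Pi.smul_apply]

/-- `hcSwapAt` is affine along rays: `hcSwapAt (q + t • v) = hcSwapAt q + t • hcSwapAt v`. [cite: Shelstad1979, §4 p. 23] -/
theorem hcSwapAt_add_smul (w : W) (x y : Fin 3) (q v : W → Fin 3 → ℝ) (t : ℝ) :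
    hcSwapAt w x y (q + t • v) = hcSwapAt w x y q + t • hcSwapAt w x y v := by
  rw [hcSwapAt_add, hcSwapAt_smul]

/-- **THE SLOT SWAP IS A CONTINUOUS LINEAR AUTOMORPHISM** (an involution) of the coordinate space. [cite: Shelstad1979, §4 property (II) p. 23] -/
theorem exists_continuousLinearEquiv_hcSwapAt [Fintype W] (w : W) (x y : Fin 3) :
    ∃ A : (W → Fin 3 → ℝ) ≃L[ℝ] (W → Fin 3 → ℝ), ∀ c, A c = hcSwapAt w x y c := by
  let Al : (W → Fin 3 → ℝ) ≃ₗ[ℝ] (W → Fin 3 → ℝ) :=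
    { toFun := hcSwapAt w x y
      invFun := hcSwapAt w x y
      map_add' := hcSwapAt_add w x y
      map_smul' := fun t c => hcSwapAt_smul w x y t c
      left_inv := hcSwapAt_hcSwapAt w x y
      right_inv := hcSwapAt_hcSwapAt w x y }
  exact ⟨Al.toContinuousLinearEquiv, fun c => rfl⟩

/-- `hcSwapAt` on a vector supported at `w`: the slots are permuted. [cite: Shelstad1979, §4 p. 23] -/
theorem hcSwapAt_single_self (w : W) (x y : Fin 3) (v : Fin 3 → ℝ) :
    hcSwapAt w x y (Pi.single w v) = Pi.single w (v ∘ ⇑(Equiv.swap x y)) := by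
  funext w' l
  by_cases h : w' = w
  · subst h; simp only [hcSwapAt_apply_self, Pi.single_eq_same, Function.comp_apply]
  · simp only [hcSwapAt_apply_of_ne h, Pi.single_eq_of_ne h]

/-- `hcSwapAt` fixes the vectors supported at another place. [cite: Shelstad1979, §4 p. 23] -/
theorem hcSwapAt_single_of_ne {w w' : W} (h : w' ≠ w) (x y : Fin 3) (v : Fin 3 → ℝ) :
    hcSwapAt w x y (Pi.single w' v) = Pi.single w' v := by
  funext w'' l
  by_cases h' : w'' = w
  · subst h'
    rw [hcSwapAt_apply_self, Pi.single_eq_of_ne (Ne.symm h), Pi.zero_apply, Pi.zero_apply]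
  · rw [hcSwapAt_apply_of_ne h']

/-- The normal direction `e_x − e_y` is reversed by the swap of `x ≠ y`. [cite: Shelstad1979, §4 p. 25] -/
theorem single_sub_single_comp_swap {x y : Fin 3} (hxy : x ≠ y) :
    ((Pi.single x 1 - Pi.single y 1 : Fin 3 → ℝ)) ∘ ⇑(Equiv.swap x y) = -(Pi.single x 1 - Pi.single y 1 : Fin 3 → ℝ) := by
  funext l
  simp only [Function.comp_apply, Pi.sub_apply, Pi.neg_apply]
  rcases eq_or_ne l x with rfl | hlx
  · rw [Equiv.swap_apply_left, Pi.single_eq_same, Pi.single_eq_same, Pi.single_eq_of_ne hxy.symm, Pi.single_eq_of_ne hxy]; ring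
  rcases eq_or_ne l y with rfl | hly
  · rw [Equiv.swap_apply_right, Pi.single_eq_same, Pi.single_eq_same, Pi.single_eq_of_ne hxy, Pi.single_eq_of_ne hxy.symm]; ring
  · rw [Equiv.swap_apply_of_ne_of_ne hlx hly, Pi.single_eq_of_ne hlx, Pi.single_eq_of_ne hly]; ring

/-- The tangential direction `e_x + e_y` is fixed by the swap. [cite: Shelstad1979, §4 p. 25] -/
theorem single_add_single_comp_swap (x y : Fin 3) :
    ((Pi.single x 1 + Pi.single y 1 : Fin 3 → ℝ)) ∘ ⇑(Equiv.swap x y) = (Pi.single x 1 + Pi.single y 1 : Fin 3 → ℝ) := by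
  funext l
  simp only [Function.comp_apply, Pi.add_apply]
  rcases eq_or_ne x y with rfl | hxy
  · rw [Equiv.swap_self, Equiv.refl_apply]
  rcases eq_or_ne l x with rfl | hlx
  · rw [Equiv.swap_apply_left, Pi.single_eq_same, Pi.single_eq_same, Pi.single_eq_of_ne hxy.symm, Pi.single_eq_of_ne hxy]; ring
  rcases eq_or_ne l y with rfl | hly
  · rw [Equiv.swap_apply_right, Pi.single_eq_same, Pi.single_eq_same, Pi.single_eq_of_ne hxy, Pi.single_eq_of_ne hxy.symm]; ring
  · rw [Equiv.swap_apply_of_ne_of_ne hlx hly]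

/-- A coordinate direction of a slot outside the pair is fixed by the swap. [cite: Shelstad1979, §4 p. 25] -/
theorem single_comp_swap_of_ne {x y i : Fin 3} (hx : i ≠ x) (hy : i ≠ y) :
    ((Pi.single i 1 : Fin 3 → ℝ)) ∘ ⇑(Equiv.swap x y) = (Pi.single i 1 : Fin 3 → ℝ) := by
  funext l
  simp only [Function.comp_apply]
  by_cases h : l = i
  · subst h; rw [Equiv.swap_apply_of_ne_of_ne hx hy]
  · rw [Pi.single_eq_of_ne h, Pi.single_eq_of_ne]
    intro h'
    apply h
    rw [← Equiv.swap_apply_of_ne_of_ne hx hy] at h'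
    exact (Equiv.swap x y).injective h'

/-- **THE SWAP REVERSES THE WALL NORMAL**: `hcSwapAt w x y (hcNrm w x y) = −hcNrm w x y`. [cite: Shelstad1979, §4 p. 25] -/
theorem hcSwapAt_hcNrm (w : W) {x y : Fin 3} (hxy : x ≠ y) : hcSwapAt w x y (hcNrm w x y) = -hcNrm w x y := by
  rw [hcNrm, hcSwapAt_single_self, single_sub_single_comp_swap hxy, Pi.single_neg]

/-- **EIGEN-ACTION OF THE SWAP ON THE ADAPTED LETTERS**: `−1` on the normal letter `(w, x)`, `+1` on every other letter. [cite: Shelstad1979, Lemma 4.3 (p. 25); §4 property (II) p. 23] -/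
theorem hcSwapAt_hcAdaptedVec (w : W) {x y : Fin 3} (hxy : x ≠ y) (l : W × Fin 3) :
    hcSwapAt w x y (hcAdaptedVec w x y l) = (if l = (w, x) then (-1 : ℝ) else 1) • hcAdaptedVec w x y l := by
  obtain ⟨w', i⟩ := l
  by_cases hw : w' = w
  · subst hw
    by_cases hi : i = x
    · subst hi
      simp only [hcAdaptedVec, if_true, hcSwapAt_single_self, single_sub_single_comp_swap hxy, Pi.single_neg, neg_smul, one_smul]
    · by_cases hi' : i = y
      · subst hi'
        have hne : ((w', i) : W × Fin 3) ≠ (w', x) := fun h => hi (Prod.mk.inj h).2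
        simp only [hcAdaptedVec, if_true, hi, if_false, hcSwapAt_single_self, single_add_single_comp_swap, hne, one_smul]
      · have hne : ((w', i) : W × Fin 3) ≠ (w', x) := fun h => hi (Prod.mk.inj h).2
        simp only [hcAdaptedVec, if_true, hi, hi', if_false, hcSwapAt_single_self, single_comp_swap_of_ne hi hi', hne, one_smul]
  · have hne : ((w', i) : W × Fin 3) ≠ (w, x) := fun h => hw (Prod.mk.inj h).1
    simp only [hcAdaptedVec, hw, if_false, hcSwapAt_single_of_ne hw, hne, one_smul]

/-- Each adapted-letter sign is `1` or `−1`. [cite: Shelstad1979, Thm. 4.7 proof p. 31] -/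
theorem letterSign_eq_one_or (w : W) (x : Fin 3) (l : W × Fin 3) : (if l = (w, x) then (-1 : ℝ) else 1) = 1 ∨ (if l = (w, x) then (-1 : ℝ) else 1) = -1 := by
  split_ifs
  · exact Or.inr rfl
  · exact Or.inl rfl

/-- **WALL POINTS ARE FIXED BY THE SWAP**: `q w x = q w y ⇒ hcSwapAt w x y q = q`. [cite: Shelstad1979, §4 p. 22] -/
theorem hcSwapAt_eq_self_of_apply_eq (w : W) {x y : Fin 3} {q : W → Fin 3 → ℝ} (h : q w x = q w y) : hcSwapAt w x y q = q := by
  funext w' l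
  by_cases hw : w' = w
  · subst hw
    rw [hcSwapAt_apply_self]
    rcases eq_or_ne l x with rfl | hlx
    · rw [Equiv.swap_apply_left, ← h]
    rcases eq_or_ne l y with rfl | hly
    · rw [Equiv.swap_apply_right, h]
    · rw [Equiv.swap_apply_of_ne_of_ne hlx hly]
  · rw [hcSwapAt_apply_of_ne hw]

/-- The swapped point read at the pair: `(hcSwapAt w x y q) w x = q w y`, `(hcSwapAt w x y q) w y = q w x`. [cite: Shelstad1979, §4 p. 23] -/
theorem hcSwapAt_apply_pair (w : W) (x y : Fin 3) (q : W → Fin 3 → ℝ) :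
    hcSwapAt w x y q w x = q w y ∧ hcSwapAt w x y q w y = q w x := by
  rw [hcSwapAt_apply_self, hcSwapAt_apply_self, Equiv.swap_apply_left, Equiv.swap_apply_right]
  exact ⟨rfl, rfl⟩

/-- The swapped point read at a slot outside the pair. [cite: Shelstad1979, §4 p. 23] -/
theorem hcSwapAt_apply_self_of_ne (w : W) {x y l : Fin 3} (hx : l ≠ x) (hy : l ≠ y) (q : W → Fin 3 → ℝ) :
    hcSwapAt w x y q w l = q w l := by
  rw [hcSwapAt_apply_self, Equiv.swap_apply_of_ne_of_ne hx hy]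

end Swap

/-! ## §2 The sign change `negXAt w` as a continuous linear involution; its action on the Cayley letters; the twist `archERhoG` -/

section NegX

/-- `negXAt w c` read coordinatewise at `w`. [cite: Shelstad1979, §4 p. 25] -/
theorem negXAt_apply_self_slot (w : W) (c : W → Fin 3 → ℝ) (l : Fin 3) : negXAt w c w l = if l = 0 then -c w 0 else c w l := by
  rw [negXAt_apply_self]
  fin_cases l <;> rfl

/-- `negXAt` is additive. [cite: Shelstad1979, §4 p. 25] -/
theorem negXAt_add (w : W) (c d : W → Fin 3 → ℝ) : negXAt w (c + d) = negXAt w c + negXAt w d := by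
  funext w' l
  by_cases h : w' = w
  · subst h
    simp only [negXAt_apply_self_slot, Pi.add_apply]
    split_ifs <;> ring
  · simp only [negXAt_apply_of_ne h, Pi.add_apply]

/-- `negXAt` is homogeneous. [cite: Shelstad1979, §4 p. 25] -/
theorem negXAt_smul (w : W) (t : ℝ) (c : W → Fin 3 → ℝ) : negXAt w (t • c) = t • negXAt w c := by
  funext w' l
  by_cases h : w' = w
  · subst h
    simp only [negXAt_apply_self_slot, Pi.smul_apply, smul_eq_mul]
    split_ifs <;> ring
  · simp only [negXAt_apply_of_ne h, Pi.smul_apply]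

/-- **THE SIGN CHANGE IS A CONTINUOUS LINEAR AUTOMORPHISM** (an involution) of the coordinate space. [cite: Shelstad1979, §4 property (II) p. 23] -/
theorem exists_continuousLinearEquiv_negXAt [Fintype W] (w : W) :
    ∃ R : (W → Fin 3 → ℝ) ≃L[ℝ] (W → Fin 3 → ℝ), ∀ c, R c = negXAt w c := by
  let Rl : (W → Fin 3 → ℝ) ≃ₗ[ℝ] (W → Fin 3 → ℝ) :=
    { toFun := negXAt w
      invFun := negXAt w
      map_add' := negXAt_add w
      map_smul' := fun t c => negXAt_smul w t c
      left_inv := negXAt_negXAt w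
      right_inv := negXAt_negXAt w }
  exact ⟨Rl.toContinuousLinearEquiv, fun c => rfl⟩

/-- `negXAt` on a vector supported at `w`. [cite: Shelstad1979, §4 p. 25] -/
theorem negXAt_single_self (w : W) (v : Fin 3 → ℝ) :
    negXAt w (Pi.single w v) = Pi.single w (fun l => if l = 0 then -v 0 else v l) := by
  funext w' l
  by_cases h : w' = w
  · subst h; simp only [negXAt_apply_self_slot, Pi.single_eq_same]
  · simp only [negXAt_apply_of_ne h, Pi.single_eq_of_ne h]

/-- `negXAt` fixes the vectors supported at another place. [cite: Shelstad1979, §4 p. 25] -/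
theorem negXAt_single_of_ne {w w' : W} (h : w' ≠ w) (v : Fin 3 → ℝ) : negXAt w (Pi.single w' v) = Pi.single w' v := by
  funext w'' l
  by_cases h' : w'' = w
  · subst h'
    simp only [negXAt_apply_self_slot, Pi.single_eq_of_ne (Ne.symm h), Pi.zero_apply, neg_zero, ite_self]
  · simp only [negXAt_apply_of_ne h']

/-- **EIGEN-ACTION OF THE SIGN CHANGE ON THE CAYLEY LETTERS**: `−1` on the image `∂_x = e_{w,0}` of the normal letter `(w, x)`, `+1` on every other Cayley letter — the SAME signs as
the swap on the adapted letters (`hcSwapAt_hcAdaptedVec`). [cite: Shelstad1979, Lemma 4.3 (p. 25); Thm. 4.7 proof p. 31] -/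
theorem negXAt_hcCayVec (w : W) (x y : Fin 3) (l : W × Fin 3) :
    negXAt w (hcCayVec w x y l) = (if l = (w, x) then (-1 : ℝ) else 1) • hcCayVec w x y l := by
  have e0 : (fun l : Fin 3 => if l = 0 then -(Pi.single (0 : Fin 3) (1 : ℝ) : Fin 3 → ℝ) 0 else (Pi.single (0 : Fin 3) (1 : ℝ) : Fin 3 → ℝ) l) =
      -(Pi.single 0 1 : Fin 3 → ℝ) := by
    funext l; fin_cases l <;> simp
  have ei : ∀ i : Fin 3, i ≠ 0 →
      (fun l : Fin 3 => if l = 0 then -(Pi.single i (1 : ℝ) : Fin 3 → ℝ) 0 else (Pi.single i (1 : ℝ) : Fin 3 → ℝ) l) = (Pi.single i 1 : Fin 3 → ℝ) := by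
    intro i hi; funext l
    by_cases hl : l = 0
    · subst hl; rw [if_pos rfl, Pi.single_eq_of_ne (Ne.symm hi), neg_zero]
    · rw [if_neg hl]
  obtain ⟨w', i⟩ := l
  by_cases hw : w' = w
  · subst hw
    by_cases hi : i = x
    · subst hi
      have h1 : hcCayVec w' i y (w', i) = Pi.single w' (Pi.single 0 1) := by simp only [hcCayVec, if_true]
      rw [h1, if_pos rfl, negXAt_single_self, e0, Pi.single_neg, neg_one_smul]
    · have hne : ((w', i) : W × Fin 3) ≠ (w', x) := fun h => hi (Prod.mk.inj h).2
      rw [if_neg hne, one_smul]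
      by_cases hi' : i = y
      · have h1 : hcCayVec w' x y (w', i) = Pi.single w' (Pi.single 2 1) := by simp only [hcCayVec, if_true, if_neg hi, if_pos hi']
        rw [h1, negXAt_single_self, ei 2 (by decide)]
      · have h1 : hcCayVec w' x y (w', i) = Pi.single w' (Pi.single 1 1) := by simp only [hcCayVec, if_true, hi, hi', if_false]
        rw [h1, negXAt_single_self, ei 1 (by decide)]
  · have hne : ((w', i) : W × Fin 3) ≠ (w, x) := fun h => hw (Prod.mk.inj h).1
    have h1 : hcCayVec w x y (w', i) = Pi.single w' (Pi.single i 1) := by simp only [hcCayVec, hw, if_false]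
    rw [h1, if_neg hne, one_smul, negXAt_single_of_ne hw]

/-- **THE CAYLEY POINT IS FIXED BY THE SIGN CHANGE** (its `x_w` is `0`). [cite: Shelstad1979, §4 p. 25] -/
theorem negXAt_hcCayPt (w : W) (x y : Fin 3) (c : W → Fin 3 → ℝ) : negXAt w (hcCayPt w x y c) = hcCayPt w x y c := by
  funext w' l
  by_cases h : w' = w
  · subst h
    rw [negXAt_apply_self_slot]
    split_ifs with hl
    · subst hl; rw [hcCayPt_apply_self_zero, neg_zero]
    · rfl
  · rw [negXAt_apply_of_ne h]

variable [Fintype W]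

/-- **THE TWIST `archERhoG S′` IS `negXAt w`-INVARIANT AT A SPLIT PLACE `w ∈ S′`** (its factor there is `1`, the other factors do not read the place `w`).
[cite: Shelstad1979, §4 p. 24] [cite: Bouaziz1994IntegralesOrbitales, §6.2 p. 591] -/
theorem archERhoG_negXAt_of_mem {S' : Finset W} {w : W} (hw : w ∈ S') (c : W → Fin 3 → ℝ) : archERhoG S' (negXAt w c) = archERhoG S' c := by
  unfold archERhoG
  refine Finset.prod_congr rfl fun w' _ => ?_
  by_cases h : w' = w
  · subst h; rw [if_pos hw, if_pos hw]
  · rw [negXAt_apply_of_ne h]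

/-- **THE TWIST `archERhoG S′` IS `C^∞`** (a product of unit exponentials of the coordinates). [cite: Shelstad1979, §4 p. 24] -/
theorem contDiff_archERhoG (S' : Finset W) : ContDiff ℝ ∞ (archERhoG S') := by
  have h : archERhoG S' = fun c => ∏ w, (if w ∈ S' then (1 : ℂ) else Complex.exp (((c w 0 : ℂ) - (c w 2 : ℂ)) * I)) := by
    funext c
    unfold archERhoG
    refine Finset.prod_congr rfl fun w _ => ?_
    split_ifs
    · rfl
    · rw [Circle.coe_exp]; push_cast; ring_nf
  rw [h]
  refine contDiff_prod fun w _ => ?_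
  split_ifs
  · exact contDiff_const
  · refine Complex.contDiff_exp.comp (ContDiff.mul (ContDiff.sub ?_ ?_) contDiff_const)
    · exact ofRealCLM.contDiff.comp ((contDiff_apply (𝕜 := ℝ) (E := ℝ) (n := ∞) (0 : Fin 3)).comp (contDiff_apply (𝕜 := ℝ) (E := Fin 3 → ℝ) (n := ∞) w))
    · exact ofRealCLM.contDiff.comp ((contDiff_apply (𝕜 := ℝ) (E := ℝ) (n := ∞) (2 : Fin 3)).comp (contDiff_apply (𝕜 := ℝ) (E := Fin 3 → ℝ) (n := ∞) w))

end NegX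

/-! ## §3 The adapted basis and the slot-difference functional (the re-labelling `slotPerm ρ` as a continuous linear automorphism is ★ `exists_continuousLinearEquiv_eq_slotPerm`, LH3-p04 (g3)) -/

section Relabel

variable [Fintype W]

omit [Fintype W] in
/-- **THE SLOT-DIFFERENCE FUNCTIONAL** `ℓ q = q w x − q w y` is a continuous linear form with `ℓ (hcNrm w x y) = 2` for `x ≠ y`. [cite: Shelstad1979, §4 p. 25] -/
theorem exists_clm_slotDiff (w : W) {x y : Fin 3} (hxy : x ≠ y) :
    ∃ ℓ : (W → Fin 3 → ℝ) →L[ℝ] ℝ, (∀ q, ℓ q = q w x - q w y) ∧ ℓ (hcNrm w x y) = 2 := by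
  let ℓ : (W → Fin 3 → ℝ) →L[ℝ] ℝ :=
    (ContinuousLinearMap.proj (R := ℝ) (φ := fun _ : Fin 3 => ℝ) x).comp (ContinuousLinearMap.proj (R := ℝ) (φ := fun _ : W => Fin 3 → ℝ) w) -
      (ContinuousLinearMap.proj (R := ℝ) (φ := fun _ : Fin 3 => ℝ) y).comp (ContinuousLinearMap.proj (R := ℝ) (φ := fun _ : W => Fin 3 → ℝ) w)
  have hℓ : ∀ q, ℓ q = q w x - q w y := fun q => by
    simp only [ℓ, sub_apply, ContinuousLinearMap.coe_comp, Function.comp_apply, ContinuousLinearMap.proj_apply]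
  refine ⟨ℓ, hℓ, ?_⟩
  rw [hℓ, hcNrm, Pi.single_eq_same, Pi.sub_apply, Pi.sub_apply, Pi.single_eq_same, Pi.single_eq_same, Pi.single_eq_of_ne hxy.symm,
    Pi.single_eq_of_ne hxy]
  ring

/-- **THE ADAPTED LETTERS FORM A BASIS**: there is `b : Module.Basis (W × Fin 3) ℝ E` with `b l = hcAdaptedVec w x y l` (`x ≠ y`): the standard basis pushed through the
invertible linear map replacing `(e_{w,x}, e_{w,y})` by `(e_{w,x} − e_{w,y}, e_{w,x} + e_{w,y})`. [cite: Shelstad1979, Lemma 4.3 (p. 25)] -/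
theorem exists_basis_hcAdaptedVec (w : W) {x y : Fin 3} (hxy : x ≠ y) :
    ∃ b : Module.Basis (W × Fin 3) ℝ (W → Fin 3 → ℝ), ∀ l, b l = hcAdaptedVec w x y l := by
  classical
  -- the block map at the place `w` and its inverse
  let M : (Fin 3 → ℝ) → (Fin 3 → ℝ) := fun v l => if l = x then v x + v y else if l = y then v y - v x else v l
  let M' : (Fin 3 → ℝ) → (Fin 3 → ℝ) := fun u l => if l = x then (u x - u y) / 2 else if l = y then (u x + u y) / 2 else u l
  have hMx : ∀ v, M v x = v x + v y := fun v => by simp only [M, if_true]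
  have hMy : ∀ v, M v y = v y - v x := fun v => by simp only [M, hxy.symm, if_false, if_true]
  have hM'x : ∀ u, M' u x = (u x - u y) / 2 := fun u => by simp only [M', if_true]
  have hM'y : ∀ u, M' u y = (u x + u y) / 2 := fun u => by simp only [M', hxy.symm, if_false, if_true]
  have hM'M : ∀ v, M' (M v) = v := by
    intro v; funext l
    by_cases hl : l = x
    · subst hl; rw [hM'x, hMx, hMy]; ring
    · by_cases hl' : l = y
      · subst hl'; rw [hM'y, hMx, hMy]; ring
      · simp only [M', M, hl, hl', if_false]
  have hMM' : ∀ u, M (M' u) = u := by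
    intro u; funext l
    by_cases hl : l = x
    · subst hl; rw [hMx, hM'x, hM'y]; ring
    · by_cases hl' : l = y
      · subst hl'; rw [hMy, hM'x, hM'y]; ring
      · simp only [M', M, hl, hl', if_false]
  have hMadd : ∀ u v, M (u + v) = M u + M v := by
    intro u v; funext l; simp only [M, Pi.add_apply]; split_ifs <;> ring
  have hMsmul : ∀ (t : ℝ) v, M (t • v) = t • M v := by
    intro t v; funext l; simp only [M, Pi.smul_apply, smul_eq_mul]; split_ifs <;> ring
  have hM0 : M 0 = 0 := by funext l; simp only [M, Pi.zero_apply, add_zero, sub_zero]; split_ifs <;> rfl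
  -- the global map
  let T : (W → Fin 3 → ℝ) ≃ₗ[ℝ] (W → Fin 3 → ℝ) :=
    { toFun := fun c => Function.update c w (M (c w))
      invFun := fun c => Function.update c w (M' (c w))
      map_add' := fun c d => by
        funext w' l
        by_cases h : w' = w
        · subst h; simp only [Function.update_self, Pi.add_apply, hMadd]
        · simp only [Function.update_of_ne h, Pi.add_apply]
      map_smul' := fun t c => by
        funext w' l
        by_cases h : w' = w
        · subst h; simp only [Function.update_self, Pi.smul_apply, hMsmul, RingHom.id_apply]
        · simp only [Function.update_of_ne h, Pi.smul_apply, RingHom.id_apply]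
      left_inv := fun c => by
        funext w' l
        by_cases h : w' = w
        · subst h; simp only [Function.update_self, hM'M]
        · simp only [Function.update_of_ne h]
      right_inv := fun c => by
        funext w' l
        by_cases h : w' = w
        · subst h; simp only [Function.update_self, hMM']
        · simp only [Function.update_of_ne h] }
  -- the standard basis indexed by `W × Fin 3`
  let e : Module.Basis (W × Fin 3) ℝ (W → Fin 3 → ℝ) :=
    (Pi.basis fun _ : W => Pi.basisFun ℝ (Fin 3)).reindex (Equiv.sigmaEquivProd W (Fin 3))
  have he : ∀ l : W × Fin 3, e l = Pi.single l.1 (Pi.single l.2 1) := by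
    intro l
    obtain ⟨w', i⟩ := l
    simp only [e, Module.Basis.reindex_apply, Equiv.sigmaEquivProd_symm_apply, Pi.basis_apply, Pi.basisFun_apply]
  refine ⟨e.map T, fun l => ?_⟩
  rw [Module.Basis.map_apply, he]
  obtain ⟨w', i⟩ := l
  show Function.update (Pi.single w' (Pi.single i (1 : ℝ))) w (M ((Pi.single w' (Pi.single i (1 : ℝ)) : W → Fin 3 → ℝ) w)) = hcAdaptedVec w x y (w', i)
  by_cases hw : w' = w
  · subst hw
    rw [Pi.single_eq_same]
    have hupd : ∀ v : Fin 3 → ℝ, Function.update (Pi.single w' (Pi.single i (1 : ℝ)) : W → Fin 3 → ℝ) w' v = Pi.single w' v := by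
      intro v; funext w'' l
      by_cases h : w'' = w'
      · subst h; simp only [Function.update_self, Pi.single_eq_same]
      · simp only [Function.update_of_ne h, Pi.single_eq_of_ne h]
    rw [hupd]
    by_cases hi : i = x
    · subst hi
      simp only [hcAdaptedVec, if_true]
      congr 1
      funext l
      simp only [M, Pi.sub_apply]
      by_cases hl : l = i
      · subst hl; simp [hxy, hxy.symm]
      · by_cases hl' : l = y
        · subst hl'; simp [hxy.symm]
        · simp [hl, hl']
    · by_cases hi' : i = y
      · subst hi'
        simp only [hcAdaptedVec, if_true, hi, if_false]
        congr 1
        funext l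
        simp only [M, Pi.add_apply]
        by_cases hl : l = x
        · subst hl; simp [hxy]
        · by_cases hl' : l = i
          · subst hl'; simp [hxy, hxy.symm]
          · simp [hl, hl']
      · simp only [hcAdaptedVec, if_true, hi, hi', if_false]
        congr 1
        funext l
        simp only [M]
        by_cases hl : l = x
        · subst hl; simp [Ne.symm hi, Ne.symm hi']
        · by_cases hl' : l = y
          · subst hl'; simp [hl, Ne.symm hi, Ne.symm hi']
          · simp [hl, hl']
  · have h0 : (Pi.single w' (Pi.single i (1 : ℝ)) : W → Fin 3 → ℝ) w = 0 := Pi.single_eq_of_ne (Ne.symm hw) _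
    rw [h0, hM0]
    simp only [hcAdaptedVec, hw, if_false]
    funext w'' l
    by_cases h : w'' = w
    · subst h; rw [Function.update_self, Pi.single_eq_of_ne (Ne.symm hw)]
    · rw [Function.update_of_ne h]

end Relabel

/-! ## §4 Small neighbourhoods of semiregular wall points -/

section Nhds

/-- **OFF THE WALL, SUCH POINTS ARE `G`-REGULAR.** [cite: Shelstad1979, §4 p. 22] -/
theorem mem_regG_of_offWall {S : Finset W} {w : W} {x y : Fin 3} (hxy : x ≠ y) {q : W → Fin 3 → ℝ}
    (h1 : |q w x - q w y| < Real.pi) (h2 : ∀ l, l ≠ x → l ≠ y → Circle.exp (q w l) ≠ Circle.exp (q w x) ∧ Circle.exp (q w l) ≠ Circle.exp (q w y))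
    (h3 : ∀ w', w' ∉ S → w' ≠ w → Function.Injective fun l : Fin 3 => Circle.exp (q w' l)) (h4 : ∀ w' ∈ S, q w' 0 ≠ 0)
    (hne : q w x ≠ q w y) : q ∈ RegG S := by
  refine ⟨fun w' hw' => ?_, h4⟩
  by_cases h : w' = w
  · subst h
    exact injective_of_pair_of_third hxy (circleExp_ne_of_abs_sub_lt_two_pi hne (by linarith [Real.pi_pos])) h2
  · exact h3 w' hw' h

omit [DecidableEq W] in
/-- **ON THE WALL, SUCH POINTS ARE SEMIREGULAR.** [cite: Shelstad1979, §4 p. 22] -/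
theorem hcSemireg_of_onWall {S : Finset W} {w : W} {x y : Fin 3} (hxy : x ≠ y) {q : W → Fin 3 → ℝ}
    (h2 : ∀ l, l ≠ x → l ≠ y → Circle.exp (q w l) ≠ Circle.exp (q w x) ∧ Circle.exp (q w l) ≠ Circle.exp (q w y))
    (h3 : ∀ w', w' ∉ S → w' ≠ w → Function.Injective fun l : Fin 3 => Circle.exp (q w' l)) (h4 : ∀ w' ∈ S, q w' 0 ≠ 0)
    (heq : q w x = q w y) : HcSemireg S w x y q :=
  ⟨heq, (h2 _ (hcThird_ne_left hxy) (hcThird_ne_right hxy)).1, h3, h4⟩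

/-- **FOR A SAME-SIGN PAIR THE WHOLE NEIGHBOURHOOD IS IN `T_{in-reg}`** (`InRegG s S` has no condition at a compact wall). [cite: Bouaziz1994IntegralesOrbitales, §6.2 p. 591] -/
theorem mem_inRegG_of_sameSign {s : W → Fin 3 → SignType} {S : Finset W} {w : W} {x y : Fin 3} (hxy : x ≠ y) (hs : s w x = s w y)
    {q : W → Fin 3 → ℝ} (h2 : ∀ l, l ≠ x → l ≠ y → Circle.exp (q w l) ≠ Circle.exp (q w x) ∧ Circle.exp (q w l) ≠ Circle.exp (q w y))
    (h3 : ∀ w', w' ∉ S → w' ≠ w → Function.Injective fun l : Fin 3 => Circle.exp (q w' l)) : q ∈ InRegG s S := by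
  intro w' hw' i j hij hsij
  by_cases h : w' = w
  · subst h
    rcases eq_or_eq_or_eq_hcThird hxy i with hi | hi | hi <;> rcases eq_or_eq_or_eq_hcThird hxy j with hj | hj | hj
    · exact absurd (hi.trans hj.symm) hij
    · exact absurd (by rw [hi, hj]; exact hs) hsij
    · rw [hi, hj]; exact ((h2 _ (hcThird_ne_left hxy) (hcThird_ne_right hxy)).1).symm
    · exact absurd (by rw [hi, hj]; exact hs.symm) hsij
    · exact absurd (hi.trans hj.symm) hij
    · rw [hi, hj]; exact ((h2 _ (hcThird_ne_left hxy) (hcThird_ne_right hxy)).2).symm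
    · rw [hi, hj]; exact (h2 _ (hcThird_ne_left hxy) (hcThird_ne_right hxy)).1
    · rw [hi, hj]; exact (h2 _ (hcThird_ne_left hxy) (hcThird_ne_right hxy)).2
    · exact absurd (hi.trans hj.symm) hij
  · exact fun he => hij (h3 w' hw' h he)

/-- **SUCH POINTS ARE `H`-REGULAR** when the colliding pair is `(1, a)`, `a ∈ {0, 2}` (the case of the head): `q ∈ RegS S`. [cite: Rogawski1990, §4.3 p. 42] -/
theorem mem_regS_of_pair_one {S : Finset W} {w : W} {a : Fin 3} (ha : a = 0 ∨ a = 2) {q : W → Fin 3 → ℝ}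
    (h2 : ∀ l, l ≠ 1 → l ≠ a → Circle.exp (q w l) ≠ Circle.exp (q w 1) ∧ Circle.exp (q w l) ≠ Circle.exp (q w a))
    (h3 : ∀ w', w' ∉ S → w' ≠ w → Function.Injective fun l : Fin 3 => Circle.exp (q w' l)) (h4 : ∀ w' ∈ S, q w' 0 ≠ 0) : q ∈ RegS S := by
  refine ⟨fun w' hw' => ?_, h4⟩
  by_cases h : w' = w
  · subst h
    rcases ha with rfl | rfl
    · exact ((h2 2 (by decide) (by decide)).2).symm
    · exact (h2 0 (by decide) (by decide)).2
  · exact fun he => absurd (h3 w' hw' h he) (by decide)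

omit [DecidableEq W] in
/-- The re-labelled point read at the re-labelled slot: `(slotPerm ρ c) w (ρ_w⁻¹ x) = c w x`. [cite: Shelstad1979, Lemma 4.2 (p. 23)] -/
theorem slotPerm_apply_symm (ρ : W → Equiv.Perm (Fin 3)) (c : W → Fin 3 → ℝ) (w : W) (x : Fin 3) : slotPerm ρ c w ((ρ w).symm x) = c w x := by
  rw [slotPerm_apply, Equiv.apply_symm_apply]

omit [DecidableEq W] in
/-- `slotPerm` is affine along rays. [cite: Shelstad1979, Lemma 4.2 (p. 23)] -/
theorem slotPerm_add_smul (ρ : W → Equiv.Perm (Fin 3)) (q v : W → Fin 3 → ℝ) (t : ℝ) : slotPerm ρ (q + t • v) = slotPerm ρ q + t • slotPerm ρ v := rfl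

omit [DecidableEq W] in
/-- **A `G`-REGULAR POINT IS OFF EVERY COMPACT WALL**: `c ∈ RegG S`, `w ∉ S`, `x ≠ y ⇒ c w x ≠ c w y`. [cite: Shelstad1979, §4 p. 22] -/
theorem apply_ne_apply_of_mem_regG {S : Finset W} {c : W → Fin 3 → ℝ} (hc : c ∈ RegG S) {w : W} (hw : w ∉ S) {x y : Fin 3} (hxy : x ≠ y) : c w x ≠ c w y :=
  fun h => hxy (hc.1 w hw (by simp only [h]))

variable [Fintype W]

/-- **A SEMIREGULAR WALL POINT HAS A SWAP-STABLE NEIGHBOURHOOD SEEING ONLY ITS OWN WALL**: around `p` with ★ `HcSemireg S w x y p` (`w ∉ S`, `x ≠ y`) there is an open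
`hcSwapAt w x y`-stable `U ∋ p` on which (i) `|q w x − q w y| < π`, (ii) the third unit eigenvalue at `w` stays off the two colliding ones, (iii) every other compact place
stays regular, (iv) every split place keeps `x ≠ 0`. [cite: Shelstad1979, §4 p. 22] [cite: Bouaziz1994IntegralesOrbitales, §3.2 p. 580] -/
theorem exists_nhds_hcSemireg {S : Finset W} {w : W} (hw : w ∉ S) {x y : Fin 3} (hxy : x ≠ y) {p : W → Fin 3 → ℝ} (hp : HcSemireg S w x y p) :
    ∃ U : Set (W → Fin 3 → ℝ), IsOpen U ∧ p ∈ U ∧ (∀ q ∈ U, hcSwapAt w x y q ∈ U) ∧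
      (∀ q ∈ U, |q w x - q w y| < Real.pi) ∧
      (∀ q ∈ U, ∀ l, l ≠ x → l ≠ y → Circle.exp (q w l) ≠ Circle.exp (q w x) ∧ Circle.exp (q w l) ≠ Circle.exp (q w y)) ∧
      (∀ q ∈ U, ∀ w', w' ∉ S → w' ≠ w → Function.Injective fun l : Fin 3 => Circle.exp (q w' l)) ∧
      (∀ q ∈ U, ∀ w' ∈ S, q w' 0 ≠ 0) := by
  obtain ⟨hp1, hp2, hp3, hp4⟩ := hp
  set k := hcThird x y with hk
  have hdiff : Continuous fun q : W → Fin 3 → ℝ => q w x - q w y := by fun_prop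
  have hO4 : IsOpen {q : W → Fin 3 → ℝ | ∀ w', w' ∉ S → w' ≠ w → Function.Injective fun l : Fin 3 => Circle.exp (q w' l)} := by
    have h : {q : W → Fin 3 → ℝ | ∀ w', w' ∉ S → w' ≠ w → Function.Injective fun l : Fin 3 => Circle.exp (q w' l)} =
        ⋂ w' ∈ {w' : W | w' ∉ S ∧ w' ≠ w}, {q : W → Fin 3 → ℝ | Function.Injective fun l : Fin 3 => Circle.exp (q w' l)} := by
      ext q
      simp only [Set.mem_setOf_eq, Set.mem_iInter, and_imp]
    rw [h]
    exact (Set.toFinite _).isOpen_biInter fun w' _ => isOpen_setOf_injective_circleExp w'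
  have hO5 : IsOpen {q : W → Fin 3 → ℝ | ∀ w' ∈ S, q w' 0 ≠ 0} := by
    have h : {q : W → Fin 3 → ℝ | ∀ w' ∈ S, q w' 0 ≠ 0} = ⋂ w' ∈ (↑S : Set W), {q : W → Fin 3 → ℝ | q w' 0 ≠ 0} := by
      ext q
      simp only [Set.mem_setOf_eq, Set.mem_iInter, Finset.mem_coe]
    rw [h]
    exact (Set.toFinite _).isOpen_biInter fun w' _ => isOpen_ne_fun ((continuous_apply 0).comp (continuous_apply w')) continuous_const
  refine ⟨{q | |q w x - q w y| < Real.pi} ∩ ({q | Circle.exp (q w k) ≠ Circle.exp (q w x)} ∩ ({q | Circle.exp (q w k) ≠ Circle.exp (q w y)} ∩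
      ({q | ∀ w', w' ∉ S → w' ≠ w → Function.Injective fun l : Fin 3 => Circle.exp (q w' l)} ∩ {q | ∀ w' ∈ S, q w' 0 ≠ 0}))),
    ?_, ?_, ?_, ?_, ?_, ?_, ?_⟩
  · -- open
    exact (isOpen_lt (continuous_abs.comp hdiff) continuous_const).inter ((isOpen_ne_fun (continuous_circleExp_coord w k) (continuous_circleExp_coord w x)).inter
      ((isOpen_ne_fun (continuous_circleExp_coord w k) (continuous_circleExp_coord w y)).inter (hO4.inter hO5)))
  · -- `p ∈ U`
    refine ⟨?_, ?_, ?_, hp3, hp4⟩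
    · show |p w x - p w y| < Real.pi
      rw [hp1, sub_self, abs_zero]; exact Real.pi_pos
    · exact hp2
    · show Circle.exp (p w k) ≠ Circle.exp (p w y)
      rw [← hp1]; exact hp2
  · -- swap-stable
    rintro q ⟨h1, h2, h3, h4, h5⟩
    have hqx := (hcSwapAt_apply_pair w x y q).1
    have hqy := (hcSwapAt_apply_pair w x y q).2
    have hqk : hcSwapAt w x y q w k = q w k := hcSwapAt_apply_self_of_ne w (hcThird_ne_left hxy) (hcThird_ne_right hxy) q
    refine ⟨?_, ?_, ?_, fun w' hw' hne => ?_, fun w' hw' => ?_⟩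
    · show |hcSwapAt w x y q w x - hcSwapAt w x y q w y| < Real.pi
      rw [hqx, hqy, abs_sub_comm]; exact h1
    · show Circle.exp (hcSwapAt w x y q w k) ≠ Circle.exp (hcSwapAt w x y q w x)
      rw [hqk, hqx]; exact h3
    · show Circle.exp (hcSwapAt w x y q w k) ≠ Circle.exp (hcSwapAt w x y q w y)
      rw [hqk, hqy]; exact h2
    · have : hcSwapAt w x y q w' = q w' := hcSwapAt_apply_of_ne hne x y q
      rw [this]; exact h4 w' hw' hne
    · have hne : w' ≠ w := fun h => hw (h ▸ hw')
      show hcSwapAt w x y q w' 0 ≠ 0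
      rw [hcSwapAt_apply_of_ne hne]; exact h5 w' hw'
  · rintro q ⟨h1, -, -, -, -⟩; exact h1
  · rintro q ⟨-, h2, h3, -, -⟩ l hlx hly
    rw [eq_hcThird_of_ne_of_ne hxy hlx hly]
    exact ⟨h2, h3⟩
  · rintro q ⟨-, -, -, h4, -⟩; exact h4
  · rintro q ⟨-, -, -, -, h5⟩; exact h5

/-- **SEMIREGULARITY IS TRANSPORTED ALONG THE RE-LABELLING**: for `ρ ∈ partnerPerms S`, `HcSemireg S w x y p ⇒ HcSemireg S w (ρ_w⁻¹ x) (ρ_w⁻¹ y) (slotPerm ρ p)`.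
[cite: Shelstad1979, Lemma 4.2 (p. 23); §4 p. 22] -/
theorem hcSemireg_slotPerm {S : Finset W} {ρ : W → Equiv.Perm (Fin 3)} (hρ : ρ ∈ partnerPerms S) {w : W} {x y : Fin 3} (hxy : x ≠ y)
    {p : W → Fin 3 → ℝ} (hp : HcSemireg S w x y p) : HcSemireg S w ((ρ w).symm x) ((ρ w).symm y) (slotPerm ρ p) := by
  obtain ⟨hp1, hp2, hp3, hp4⟩ := hp
  rw [mem_partnerPerms_iff] at hρ
  refine ⟨?_, ?_, fun w' hw' hne => ?_, fun w' hw' => ?_⟩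
  · rw [slotPerm_apply_symm, slotPerm_apply_symm]; exact hp1
  · have h : ρ w (hcThird ((ρ w).symm x) ((ρ w).symm y)) = hcThird x y := by
      rw [perm_hcThird (ρ w) (fun h => hxy ((ρ w).symm.injective h)), Equiv.apply_symm_apply, Equiv.apply_symm_apply]
    rw [slotPerm_apply, slotPerm_apply_symm, h]; exact hp2
  · intro i j h
    exact (ρ w').injective (hp3 w' hw' hne (by simpa only [slotPerm_apply] using h))
  · rw [slotPerm_apply, hρ w' hw', Equiv.Perm.coe_one, id]; exact hp4 w' hw'

end Nhds

end Literature.NumberTheory.Rogawski1990
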